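import Mathlib
import Literature.MathematicalPhysics.QuantumFieldTheory.Balaban1983to89.B10LogDet63
import Literature.MathematicalPhysics.QuantumFieldTheory.Balaban1983to89.B9Thm314

/-!
# `Balaban1983to89.B10Eq25Rate` — [Balaban1985UV3] (23) ⇒ (25) p. 262: the walk-term factor of [5] (3.108) BY NAME
# (`B9.walkFactor`), the rescaling *"if the big blocks are scaled to unit cubes"*, and the rate κ(M₁) of (25) made
# explicit — kernel-checked bookkeeping; first consumer of the typed (25) carrier `B10.Bound25Printed`

T. Bałaban, *Ultraviolet stability of three-dimensional lattice pure gauge field theories*, Commun. Math. Phys. **102**,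
255–275 (1985) [Balaban1985UV3] (cell paper B10; PDF `paper:balaban1985-cmp102-uv-stability-3d`, journal page = PDF
page + 254); [5] of the paper = T. Bałaban, *Propagators for lattice gauge theories in a background field*, Commun.
Math. Phys. **99**, 389–434 (1985) [Balaban1985BackgroundPropagators] (cell paper B9).  Sibling of `…Balaban1983to89.B10`
(whose header records: *"[5] = `…B9` (…) cited in docstrings only (no d = 3 record of them is typed)"*), of
`…B10LogDet63` (§3: the regrouping *"Summing the expressions with the same localization X"* for walk terms obeying the
ABSTRACT shape `K·q^{|ω|}·e^{−r·d(dom)}`) and of `…B9` / `…B9Thm314` (the typed factor of (3.94)/(3.108):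
`B9.walkFactor`, `B9Thm314.walkFactorS`).  This module is the BY-NAME EDGE between them: B9's printed factor in, B10's
printed (25) out, with the rate κ of (25) as an explicit function of M₁.

CITATION HEADER (lean-in-tree rule).  WHAT IS REPRODUCED, verbatim from the renders READ AS IMAGES for this module
(B10 p. 262 [PDF 8]; B9 p. 410 [PDF 22], p. 416 [PDF 28]):
* B10 p. 262: *"A line of the graph connecting vertices □_i, □_j is replaced by a random walk ω = ((α₀, X₀), (α₁, X₁),
  …, (αₙ, Xₙ)) satisfying □_i ∩ X₀ ≠ ∅, X_{m−1} ∩ X_m ≠ ∅, m = 1, …, n, X_m ∩ □_j ≠ ∅ᵃ. A term in the expression,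
  corresponding to the walk ω, satisfies the bound (3.108) [5], i.e. can be bounded by*
  `O(1)O(M₁^{−(1/2)})^{|ω|}M₁^{−(1/2)|ω|} exp(−½δ₀d(ω, □_i, □_j))` (23), *where d(ω, □_i, □_j) is the length of a
  shortest tree graph passing through □_i, □_j, {X_m}. Let us recall that the sets X_m are connected unions of several
  big blocks. The localizations {□_i} and the walks ω replacing lines of the graph define a localization X of the
  considered expression. This localization is simply a union of all these sets. It is easy to see that, because of the
  bound (23), the expressions corresponding to big localization sets X are very small, especially if X is not contained
  in a cube of the size RM₁, then the exponential factor in (23) yields the factor exp(−R), which is smaller than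
  arbitrary power of ε. […] Summing the expressions with the same localization X we get finally the inequality"* (24)
  *"where the sum is over localizations X which have diameter smaller than RM₁. Localizations X are connected unions of
  big blocks. Following [19] we define a linear size 𝓛(X) of a localization X as the length of a shortest tree graph
  connecting the centers of big blocks in X, and other points, if the big blocks are scaled to unit cubes, i.e. the
  distance between centers of neighbouring blocks is taken to be equal to 1. With this definition we have*
  `|𝒫′₁(g₀, X, U₁)| ≦ O(g₀)e^{−κ𝓛(X)}` (25), *where κ can be arbitrarily large if M₁ is sufficiently large."*
  (ᵃ the empty set is printed as φ.)
* B9 p. 410, (3.93): *"Let us define a distance relative to the walk ω by* `d(ω, y, y′) = inf_{(y₁,y₂,…,yₙ)} (d(y, y₁)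
  + d(y₁, y₂) + ⋯ + d(y_{n−1}, yₙ) + d(yₙ, y′))`, (3.93) *the infimum is taken over all sequences (y₁, y₂, …, yₙ) of
  points yᵢ ∈ □ᵢ ∈ 𝔅."*; and the closing sentence of p. 410: *"We will use the factor O(M^{−1/2}) to control the sum over
  random walks ω, and the last two factors in (3.94) will be important for other purposes."*
* B9 p. 416, (3.108): *"A term in this expansion, corresponding to a walk ω, depends on configuration U restricted to
  X̃⁵₀ ∪ X̃⁵₁ ∪ … ∪ X̃⁵ₙ, satisfies the inequality* `|(R₀(X₀)R_{α₁}(X₁)·…·R_{αₙ}(Xₙ)J)(x)| ≦ O(1)(Lʲη)²O(M^{−1/2})^{|ω|}·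
  M^{−1/2|ω|}e^{−(1/2)δ₀d(ω,y,y′)}|J|, x ∈ Δ(y), y ∈ Λ_j, supp J ⊂ Δ(y′)`, (3.108) *[…] The constant O(1) depends on d
  and L only."* — typed in the tree as `B9.Thm310Printed`, whose bound is `len y ^ 2 * B9.walkFactor C c M δ₀ |ω| d(ω,y,y′)
  * supNorm J`.

WHAT IS KERNEL-CERTIFIED (real arithmetic over the tree's abstract carriers; no object of the series is constructed):
* §1 `walkFactor_eq` — the closed form of the factor common to (3.94)/(3.108)/(23):
  `B9.walkFactor C c M δ₀ n d = C·(c/M)ⁿ·e^{−½δ₀d}` (the two printed half-powers of M recombined; via the sibling's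
  `B9Thm314.walkFactor_eq_walkFactorS`).
* §2 two NAMED HYPOTHESIS SHAPES over the §3-carriers of `…B10LogDet63` (walk states `Q` — the big blocks □ of (3.90) or
  the localization sets X_m of (3.107)/(23) —, anchors `S`, walks `B9Thm37Sum.walksFrom`, localization domains `dom`):
  `WalkTermBound23` = the bound (23) with B9's factor BY NAME (`‖term b ω‖ ≤ A · B9.walkFactor C c M δ₀ |ω| d(ω)`, `A` =
  the walk-independent prefactor: the *"unessential"* (Lʲη)² of p. 410, |J|, and the vertex factors carrying the O(g₀) of
  (25)); `RescaleLaw` = the sentence *"if the big blocks are scaled to unit cubes"* as an inequality between the block-unit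
  tree length 𝓛 of the localization domain and the lattice-unit walk distance of (23):
  `M·𝓛(dom b ω) ≤ Λ·d(ω) + M·(ℓ₀|ω| + ℓ₁)` with a distortion Λ and slacks ℓ₀ (per step), ℓ₁.  THE IDEAL LAW `M·𝓛 ≤ d`
  IS NOT AVAILABLE: by (3.93) d(ω, ·, ·) is an infimum over chains through ONE point of each localization set, blind to
  the set's own extent (≤ *"several"*, say s₀, big blocks), while 𝓛(X) must reach every block centre of X = ⋃ X_m.  What
  the paper's geometry does give (located, not typed — cell GAPS C-b10g12-1): the TUBE law (T) `Λ = O(s₀²)`, `ℓ₀ = 0`,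
  `ℓ₁ = O(s₀³)` (X lies in the (s₀√3M)-neighbourhood of the optimal tree; a tree of length d has an r-net of ≤ 2d/r + 1
  points) and the COUNT law (N) `Λ = 0`, `ℓ₀ = √3s₀` (X has ≤ s₀(|ω| + 1) + 2 blocks).
* §3 `term_le_of_bound23` — PER TERM: (23) + the law give, for EVERY rate `κ ≥ 0` with `2κΛ ≤ δ₀M`,
  `‖term b ω‖ ≤ A·C·e^{κℓ₁} · (c·e^{κℓ₀}/M)^{|ω|} · e^{−κ𝓛(dom b ω)}` — the decay in 𝓛 is bought from the exponential
  factor of (23) (rate up to `½δ₀M/Λ`); a per-step slack costs `e^{κℓ₀}` PER STEP, to be paid by the per-step smallness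
  `c/M` (p. 410: *"We will use the factor O(M^{−1/2}) to control the sum over random walks"*).
* §4 `logHalfBound_of_bound23` — regrouped by localization (`B10LogDet63.Elog`, `B10LogDet63.logHalfBound_of_walks` BY
  NAME): the per-cube shape `B13.LogHalfBound` with rate κ and constant `A·C·e^{κℓ₁}·V/(1 − D𝔤·c·e^{κℓ₀}/M)` under the
  ENTROPY CONDITION `D𝔤·c·e^{κℓ₀} < M` (D𝔤 = the walk-state adjacency count, V = anchors per state); `rate25` — the
  sentence of (25) *"κ can be arbitrarily large if M₁ is sufficiently large"* AS A THEOREM WITH ITS THRESHOLD: for every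
  κ ≥ 0 and every `M ≥ max(2κΛ/δ₀, 2·D𝔤·c·e^{κℓ₀})` the shape holds with rate κ and the constant `2·A·C·e^{κℓ₁}·V`,
  UNIFORM IN M — under (T) this is `κ ≤ ½δ₀M₁/Λ`, LINEAR in M₁ with the κ-free entropy threshold `2D𝔤c ≤ M₁` (the printed
  *"the exponential factor in (23) yields the factor exp(−R)"*), under (N) alone it is `κ < log(M₁/(D𝔤c))/ℓ₀`
  (`entropy_iff`; the mechanism of the sibling's `logHalfBound_of_walks_linear`) — either way arbitrarily large, as
  printed; `rate_obstruction` — why the form of the law matters: under (N) alone the per-step price is unavoidable inside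
  the shape.
* §5 `activitiesOf`, `bound25_of_bound118`, `bound25_of_bound23` — the edge INTO the typed (25) carrier of `…B10`: a
  localized family over a `LocDomainSys` obeying `B13.Bound118` (= [Balaban1987RG1] (1.18), the d = 4 twin of (25)) on
  spaces containing the real configurations `R` IS a `B10.PolymerActivities` obeying `B10.Bound25Printed` (𝓛 = the tree
  length, activity = the norm of the complex activity); composed with §4 and the volume law `B13.VolBoundK1`
  (`B13.bound118_of_logHalfBound` BY NAME): (23)-bounded walk terms with prefactor `A₀·g` give (25) with `O(g₀) =
  (2A₀CVc₁e^{κℓ₁})·g₀` and rate `κ − 1`, for all M past the threshold.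

WHAT IS NOT CERTIFIED (hypotheses / leaves; cell GAPS rows in brackets): the expansion itself and the bound (23) for the
actual perturbative expressions of pp. 261–262 (cluster expansion "as in [9], [10]", analyticity in U₁ — G-B10-04); the
rescaling law for the paper's concrete geometry (unions of big blocks in T₁ are not modelled — DIVERGENCE F5; the law is
the hypothesis `RescaleLaw`; neither of its two printed-geometry instances (T)/(N) is typed, the r-net count behind (T)
is recorded in the cell's GAPS C-b10g12-1 only); graphs
with SEVERAL lines (p. 262: at most six vertices, eight legs): the per-term inequality §3 applies line by line, but the
regrouping §4 is typed for ONE walk per term (the (63)/log-det terms of `…B10LogDet63`, one-line graphs) — the finite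
product version is not typed; the restriction of (24) to *"localizations X which have diameter smaller than RM₁"* and the
`O(ε^κ)|T₁|` remainder (not needed for the shape); the three properties (26) ff. of 𝒫′₁.  Value = kernel edge B9 (3.108)
→ B10 (23)/(25) by name + a located reading of the rate, NOT summit progress; every statement is d-independent.

## References
* [Balaban1985UV3] T. Bałaban, Commun. Math. Phys. 102 (1985) 255–275 — (23), (24), (25) p. 262.
* [Balaban1985BackgroundPropagators] T. Bałaban, Commun. Math. Phys. 99 (1985) 389–434 — (3.93), (3.94) p. 410; Thm 3.10,
  (3.107)–(3.108) pp. 415–416.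
* [Balaban1987RG1] T. Bałaban, Commun. Math. Phys. 109 (1987) 249–301 — (1.18) p. 263 (the d = 4 twin of (25), typed as
  `B13.Bound118`).
-/

noncomputable section

open Set Filter Finset
open scoped Real Topology

namespace Literature.MathematicalPhysics.QuantumFieldTheory.Balaban1983to89.B10Eq25Rate

open Literature.MathematicalPhysics.QuantumFieldTheory.Balaban1983to89

/-! ## §1. The factor of (3.94)/(3.108)/(23) in closed form -/

section Factor

/-- **(23) p. 262 = (3.108) [5]**: the printed factor `O(1)·O(M^{−1/2})^{|ω|}·M^{−½|ω|}·e^{−½δ₀d}` — typed in the tree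
as `B9.walkFactor C c M δ₀ |ω| d` — equals `C·(c/M)^{|ω|}·e^{−½δ₀d}`: the two half-powers of M recombine into ONE small
factor `c/M` per step (p. 410: *"There are two important factors, one is a product of the factors O(M^{−1}), and one is
an exponential factor, connected with this in (3.89)."*).  Via the sibling's `B9Thm314.walkFactor_eq_walkFactorS` (s = 1). [cite: Balaban1985UV3, (23) p.262] -/
theorem walkFactor_eq {C c M δ₀ d : ℝ} {n : ℕ} (hM : 0 < M) :
    B9.walkFactor C c M δ₀ n d = C * (c / M) ^ n * Real.exp (-(δ₀ / 2 * d)) := by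
  rw [B9Thm314.walkFactor_eq_walkFactorS hM]
  unfold B9Thm314.walkFactorS
  rw [Real.rpow_neg_one]
  ring

/-- The factor is antitone in the tree length (δ₀ ≥ 0): a LOWER bound on d(ω, □_i, □_j) may be inserted. [folklore] -/
theorem walkFactor_antitone {C c M δ₀ d d' : ℝ} {n : ℕ} (hC : 0 ≤ C) (hc : 0 ≤ c) (hM : 0 < M) (hδ : 0 ≤ δ₀)
    (h : d ≤ d') : B9.walkFactor C c M δ₀ n d' ≤ B9.walkFactor C c M δ₀ n d := by
  rw [walkFactor_eq hM, walkFactor_eq hM]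
  have hP : 0 ≤ C * (c / M) ^ n := by positivity
  exact mul_le_mul_of_nonneg_left (Real.exp_le_exp.mpr (by nlinarith)) hP

end Factor

/-! ## §2. The two hypothesis shapes: (23) with B9's factor by name, and the rescaling sentence of p. 262 -/

section Shapes

variable {D : LocDomainSys} {Q : Type} [DecidableEq Q] {S : Type} {Φ : Type*}

/-- **(23) p. 262, BY NAME of [5] (3.108)**: every walk term of the expansion, anchored at `b` (the vertex cube □_i, or
the site carrying a resolvent entry in (63)) with walk `ω` of `|ω| = n` steps through the walk states `Q`, is bounded on
the analyticity space of its localization domain by `A · B9.walkFactor C c M δ₀ n (wd b ω)`: `wd b ω` = d(ω, □_i, □_j)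
(*"the length of a shortest tree graph passing through □_i, □_j, {X_m}"*, measured in lattice units as in (3.93)),
`C, c, δ₀` = the constants of (3.108) (*"The constant O(1) depends on d and L only"*), `A ≥ 0` = the walk-independent
prefactor ((Lʲη)², |J|, vertex factors — the O(g₀) of (25) lives here).  Hypothesis shape; the expansion is not
constructed (GAPS G-B10-04). [cite: Balaban1985UV3, (23) p.262] -/
def WalkTermBound23 (D : LocDomainSys) (nbrs : Q → Finset Q) (cube : S → Q) (dom : S → List Q → D.Dom)
    (sp : D.Dom → Set Φ) (term : S → List Q → Φ → ℂ) (wd : S → List Q → ℝ) (A C c M δ₀ : ℝ) : Prop :=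
  ∀ (b : S) (n : ℕ) (ω : List Q) (φ : Φ), ω ∈ B9Thm37Sum.walksFrom nbrs n (cube b) → φ ∈ sp (dom b ω) →
    ‖term b ω φ‖ ≤ A * B9.walkFactor C c M δ₀ n (wd b ω)

/-- **The rescaling sentence of p. 262** (*"a linear size 𝓛(X) … the length of a shortest tree graph connecting the
centers of big blocks in X, and other points, if the big blocks are scaled to unit cubes"*) against the lattice-unit
tree length of (23): `M · 𝓛(dom b ω) ≤ Λ · d(ω, □_i, □_j) + M·(ℓ₀·|ω| + ℓ₁)` (and `d ≥ 0`), with a DISTORTION `Λ`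
and slacks `ℓ₀` (per step), `ℓ₁`.  The ideal rescaling `M·𝓛 ≤ d` (Λ = 1, ℓ₀ = ℓ₁ = 0) is NOT available: by (3.93) [5]
the walk distance is an infimum over chains through ONE point of each localization set X_m, blind to the set's own
extent (a connected union of *"several"* — say ≤ s₀ — big blocks), while 𝓛(X) must reach every block centre of
X = ⋃ X_m.  Two instances hold in the paper's geometry (neither is typed — unions of big blocks are not modelled,
DIVERGENCE F5; cell GAPS C-b10g12-1): (T) the TUBE law `Λ = O(s₀²)`, `ℓ₀ = 0`, `ℓ₁ = O(s₀³)` — X lies in the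
(s₀√3·M)-neighbourhood of the optimal tree, and a tree of length d has an r-net of ≤ 2d/r + 1 points —, under which
§4 gives the rate `κ ≤ ½δ₀M/Λ`, LINEAR in M (the printed *"the exponential factor in (23) yields the factor
exp(−R)"*); (N) the COUNT law `Λ = 0`, `ℓ₀ = √3·s₀` (X has ≤ s₀(|ω| + 1) + 2 blocks), under which the rate comes from
the per-step smallness alone, `κ < log(M/(D𝔤·c))/ℓ₀` (`entropy_iff`; the mechanism of the sibling's
`B10LogDet63.logHalfBound_of_walks_linear`).  Hypothesis shape. [cite: Balaban1985UV3, p.262 (before (25))] -/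
def RescaleLaw (D : LocDomainSys) (nbrs : Q → Finset Q) (cube : S → Q) (dom : S → List Q → D.Dom)
    (wd : S → List Q → ℝ) (M Λ ℓ₀ ℓ₁ : ℝ) : Prop :=
  ∀ (b : S) (n : ℕ) (ω : List Q), ω ∈ B9Thm37Sum.walksFrom nbrs n (cube b) →
    0 ≤ wd b ω ∧ M * D.dj (dom b ω) ≤ Λ * wd b ω + M * (ℓ₀ * n + ℓ₁)

end Shapes

/-! ## §3. Per term: the exponential factor of (23) rescaled, at the price `e^{κℓ₀}` per step -/

section PerTerm

variable {D : LocDomainSys} {Q : Type} [DecidableEq Q] {S : Type} {Φ : Type*}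
  {nbrs : Q → Finset Q} {cube : S → Q} {dom : S → List Q → D.Dom} {sp : D.Dom → Set Φ}
  {term : S → List Q → Φ → ℂ} {wd : S → List Q → ℝ} {A C c M δ₀ Λ ℓ₀ ℓ₁ κ : ℝ}

/-- The exponent bookkeeping: from `2κΛ ≤ δ₀M`, `κ, d ≥ 0` and `M·𝓛 ≤ Λd + M(ℓ₀n + ℓ₁)`,
`−½δ₀·d ≤ κℓ₁ + n·κℓ₀ − κ·𝓛`. [folklore] -/
theorem exponent_le {d L : ℝ} {n : ℕ} (hM : 0 < M) (hκ : 0 ≤ κ) (hκM : 2 * κ * Λ ≤ δ₀ * M)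
    (hd : 0 ≤ d) (hL : M * L ≤ Λ * d + M * (ℓ₀ * n + ℓ₁)) :
    -(δ₀ / 2 * d) ≤ κ * ℓ₁ + (n : ℝ) * (κ * ℓ₀) + -(κ * L) := by
  have i : κ * (M * L) ≤ κ * (Λ * d + M * (ℓ₀ * n + ℓ₁)) := mul_le_mul_of_nonneg_left hL hκ
  have ii : 2 * κ * Λ * d ≤ δ₀ * M * d := mul_le_mul_of_nonneg_right hκM hd
  have key : M * (-(δ₀ / 2 * d)) ≤ M * (κ * ℓ₁ + (n : ℝ) * (κ * ℓ₀) + -(κ * L)) := by nlinarith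
  exact le_of_mul_le_mul_left key hM

/-- **(23) rescaled, per term.**  Under `WalkTermBound23` and `RescaleLaw`, for EVERY rate `κ ≥ 0` with
`2κΛ ≤ δ₀M`: `‖term b ω‖ ≤ A·C·e^{κℓ₁} · (c·e^{κℓ₀}/M)^{|ω|} · e^{−κ·𝓛(dom b ω)}` on the space of its domain — the
abstract shape `K·qⁿ·e^{−r·d(dom)}` of `B10LogDet63.logHalfBound_of_walks` with `K = A·C·e^{κℓ₁}`, `q = c·e^{κℓ₀}/M`,
`r = κ`.  The decay in 𝓛 comes from the exponential factor of (23) (*"the exponential factor in (23) yields the factor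
exp(−R)"*), distorted by Λ; a per-step slack ℓ₀ costs `e^{κℓ₀}` per step, charged to the per-step smallness `c/M`.
[cite: Balaban1985UV3, (23)–(25) p.262] -/
theorem term_le_of_bound23 (hM : 0 < M) (hA : 0 ≤ A) (hC : 0 ≤ C) (hc : 0 ≤ c) (hκ : 0 ≤ κ)
    (hκM : 2 * κ * Λ ≤ δ₀ * M) (h23 : WalkTermBound23 D nbrs cube dom sp term wd A C c M δ₀)
    (hsc : RescaleLaw D nbrs cube dom wd M Λ ℓ₀ ℓ₁) {b : S} {n : ℕ} {ω : List Q} {φ : Φ}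
    (hω : ω ∈ B9Thm37Sum.walksFrom nbrs n (cube b)) (hφ : φ ∈ sp (dom b ω)) :
    ‖term b ω φ‖ ≤ A * C * Real.exp (κ * ℓ₁) * (c * Real.exp (κ * ℓ₀) / M) ^ n *
      Real.exp (-(κ * D.dj (dom b ω))) := by
  obtain ⟨hwd, hdj⟩ := hsc b n ω hω
  have h1 := h23 b n ω φ hω hφ
  rw [walkFactor_eq hM] at h1
  have key := exponent_le (L := D.dj (dom b ω)) hM hκ hκM hwd hdj
  have hexp : Real.exp (-(δ₀ / 2 * wd b ω)) ≤
      Real.exp (κ * ℓ₁) * Real.exp (κ * ℓ₀) ^ n * Real.exp (-(κ * D.dj (dom b ω))) := by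
    rw [← Real.exp_nat_mul, ← Real.exp_add, ← Real.exp_add]
    exact Real.exp_le_exp.mpr key
  have hP : 0 ≤ A * (C * (c / M) ^ n) := by positivity
  calc ‖term b ω φ‖ ≤ A * (C * (c / M) ^ n * Real.exp (-(δ₀ / 2 * wd b ω))) := h1
    _ = A * (C * (c / M) ^ n) * Real.exp (-(δ₀ / 2 * wd b ω)) := by ring
    _ ≤ A * (C * (c / M) ^ n) *
          (Real.exp (κ * ℓ₁) * Real.exp (κ * ℓ₀) ^ n * Real.exp (-(κ * D.dj (dom b ω)))) :=
        mul_le_mul_of_nonneg_left hexp hP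
    _ = A * C * Real.exp (κ * ℓ₁) * (c * Real.exp (κ * ℓ₀) / M) ^ n * Real.exp (-(κ * D.dj (dom b ω))) := by
        rw [div_pow, div_pow, mul_pow]; ring

end PerTerm

/-! ## §4. Regrouped by localization: the shape of (25) with its rate and threshold explicit -/

section Regrouped

variable {D : LocDomainSys} [DecidableEq D.Dom] {Q : Type} [DecidableEq Q] {S : Type} [Fintype S] {Φ : Type*}
  {nbrs : Q → Finset Q} {cube : S → Q} {dom : S → List Q → D.Dom} {sp : D.Dom → Set Φ}
  {term : S → List Q → Φ → ℂ} {wd : S → List Q → ℝ} {cubes : D.Dom → Finset Q} {Dg V : ℕ}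
  {A C c M δ₀ Λ ℓ₀ ℓ₁ κ : ℝ}

/-- **(23) ⇒ the per-cube shape of (25)** (*"Summing the expressions with the same localization X"*, by
`B10LogDet63.logHalfBound_of_walks` BY NAME): if every walk state meets at most `D𝔤` states, every state anchors at most
`V` terms, and the ENTROPY CONDITION `D𝔤·(c·e^{κℓ₀}/M) < 1` holds, then the regrouped terms `Elog X` obey
`B13.LogHalfBound` with rate `κ` (any `κ ≥ 0` with `2κΛ ≤ δ₀M`) and per-cube constant
`A·C·e^{κℓ₁}·V/(1 − D𝔤·c·e^{κℓ₀}/M)`. [cite: Balaban1985UV3, (23)–(25) p.262] -/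
theorem logHalfBound_of_bound23 (hD : ∀ q, (nbrs q).card ≤ Dg)
    (hV : ∀ q : Q, (univ.filter fun b : S => cube b = q).card ≤ V)
    (hstart : ∀ b n ω, ω ∈ B9Thm37Sum.walksFrom nbrs n (cube b) → cube b ∈ cubes (dom b ω))
    (hM : 0 < M) (hA : 0 ≤ A) (hC : 0 ≤ C) (hc : 0 ≤ c) (hκ : 0 ≤ κ) (hκM : 2 * κ * Λ ≤ δ₀ * M)
    (hent : Dg * (c * Real.exp (κ * ℓ₀) / M) < 1)
    (h23 : WalkTermBound23 D nbrs cube dom sp term wd A C c M δ₀) (hsc : RescaleLaw D nbrs cube dom wd M Λ ℓ₀ ℓ₁) :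
    B13.LogHalfBound D sp (B10LogDet63.Elog nbrs cube dom term) (fun X => (cubes X).card)
      (A * C * Real.exp (κ * ℓ₁) * V / (1 - Dg * (c * Real.exp (κ * ℓ₀) / M))) κ :=
  B10LogDet63.logHalfBound_of_walks hD hV hstart (by positivity) (by positivity) hent
    fun b n ω φ hω hφ => term_le_of_bound23 hM hA hC hc hκ hκM h23 hsc hω hφ

/-- **(25): *"where κ can be arbitrarily large if M₁ is sufficiently large"* — with the threshold.**  For every
`κ ≥ 0` and every `M ≥ max(2κΛ/δ₀, 2·D𝔤·c·e^{κℓ₀})` (δ₀ > 0): the regrouped terms obey `B13.LogHalfBound` with rate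
`κ` and the constant `2·A·C·e^{κℓ₁}·V`, UNIFORM IN M.  The first threshold makes the rate available from the
exponential factor of (23) (under the tube law (T), ℓ₀ = 0, it is the only M-dependence: κ up to `½δ₀M/Λ`), the second
is the entropy condition with room ½. [cite: Balaban1985UV3, (25) p.262] -/
theorem rate25 (hD : ∀ q, (nbrs q).card ≤ Dg)
    (hV : ∀ q : Q, (univ.filter fun b : S => cube b = q).card ≤ V)
    (hstart : ∀ b n ω, ω ∈ B9Thm37Sum.walksFrom nbrs n (cube b) → cube b ∈ cubes (dom b ω))
    (hM : 0 < M) (hA : 0 ≤ A) (hC : 0 ≤ C) (hc : 0 ≤ c) (hδ₀ : 0 < δ₀) (hκ : 0 ≤ κ)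
    (hMκ : 2 * κ * Λ / δ₀ ≤ M) (hMent : 2 * (Dg * (c * Real.exp (κ * ℓ₀))) ≤ M)
    (h23 : WalkTermBound23 D nbrs cube dom sp term wd A C c M δ₀) (hsc : RescaleLaw D nbrs cube dom wd M Λ ℓ₀ ℓ₁) :
    B13.LogHalfBound D sp (B10LogDet63.Elog nbrs cube dom term) (fun X => (cubes X).card)
      (2 * (A * C * Real.exp (κ * ℓ₁) * V)) κ := by
  have hκM : 2 * κ * Λ ≤ δ₀ * M := by
    have := (div_le_iff₀ hδ₀).mp hMκ
    linarith [this]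
  have hq : Dg * (c * Real.exp (κ * ℓ₀) / M) ≤ 1 / 2 := by
    rw [← mul_div_assoc, div_le_iff₀ hM]
    linarith
  have hent : Dg * (c * Real.exp (κ * ℓ₀) / M) < 1 := lt_of_le_of_lt hq (by norm_num)
  have h := logHalfBound_of_bound23 (cubes := cubes) hD hV hstart hM hA hC hc hκ hκM hent h23 hsc
  have hK : 0 ≤ A * C * Real.exp (κ * ℓ₁) * V := by positivity
  refine B10LogDet63.logHalfBound_mono ?_ le_rfl (by positivity) h
  rw [div_le_iff₀ (by linarith)]
  nlinarith

/-- **The entropy condition read as a bound on the rate**: for `D𝔤, c, M > 0`,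
`D𝔤·(c·e^{κℓ₀}/M) < 1 ↔ κ·ℓ₀ < log(M/(D𝔤·c))` — under the count law (N) (ℓ₀ > 0) the rate the per-step smallness
alone can carry is `κ < log(M₁/(D𝔤·c))/ℓ₀`: arbitrarily large with M₁, but only logarithmically; the linear rate
`½δ₀M₁/Λ` needs the tube law (T) (ℓ₀ = 0, where the condition is the κ-free `D𝔤·c < M`). [folklore] -/
theorem entropy_iff {Dg c M κ ℓ₀ : ℝ} (hDg : 0 < Dg) (hc : 0 < c) (hM : 0 < M) :
    Dg * (c * Real.exp (κ * ℓ₀) / M) < 1 ↔ κ * ℓ₀ < Real.log (M / (Dg * c)) := by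
  rw [Real.lt_log_iff_exp_lt (by positivity), lt_div_iff₀ (by positivity), ← mul_div_assoc, div_lt_one hM]
  constructor <;> intro h <;> nlinarith [h]

/-- **Why the form of the law matters** (sharpness inside the abstract shape).  If a family of terms saturated (23)
with walk distance 0 along domains of tree length `ℓ₀·|ω|` — one term `A·(c/M)ⁿ` (A > 0) for each n, in a domain with
`𝓛 = ℓ₀·n` —, a bound of rate κ along the family, `A·(c/M)ⁿ ≤ B·e^{−κℓ₀n}` for all n, would force `c·e^{κℓ₀} ≤ M`:
under the count law (N) alone the per-step price of §3 is unavoidable.  In the paper's geometry such a family does NOT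
exist beyond bounded |ω| — a walk cannot accumulate extent without its tree length growing, which is the content of the
tube law (T). [folklore] -/
theorem rate_obstruction {A B c M κ ℓ₀ : ℝ} (hA : 0 < A) (hM : 0 < M)
    (h : ∀ n : ℕ, A * (c / M) ^ n ≤ B * Real.exp (-(κ * (ℓ₀ * n)))) :
    c * Real.exp (κ * ℓ₀) ≤ M := by
  by_contra hlt
  rw [not_le] at hlt
  set x : ℝ := c * Real.exp (κ * ℓ₀) / M with hx
  have hx1 : 1 < x := by rw [hx, lt_div_iff₀ hM]; linarith
  -- along the family, A·xⁿ ≤ B for every n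
  have hbd : ∀ n : ℕ, A * x ^ n ≤ B := by
    intro n
    have hn := h n
    have he : 0 < Real.exp (κ * (ℓ₀ * n)) := Real.exp_pos _
    have hmul := mul_le_mul_of_nonneg_right hn he.le
    have h2 : B * Real.exp (-(κ * (ℓ₀ * n))) * Real.exp (κ * (ℓ₀ * n)) = B := by
      rw [mul_assoc, ← Real.exp_add]; simp
    have h3 : A * (c / M) ^ n * Real.exp (κ * (ℓ₀ * n)) = A * x ^ n := by
      rw [hx, div_pow, div_pow, mul_pow, ← Real.exp_nat_mul]; ring_nf
    rw [h2, h3] at hmul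
    exact hmul
  -- but xⁿ → ∞
  have htend : Tendsto (fun n : ℕ => A * x ^ n) atTop atTop :=
    Tendsto.const_mul_atTop hA (tendsto_pow_atTop_atTop_of_one_lt hx1)
  obtain ⟨n, hn⟩ := (htend.eventually (eventually_gt_atTop B)).exists
  exact absurd (hbd n) (not_le.mpr hn)

end Regrouped

/-! ## §5. The edge into the typed (25) carrier `B10.Bound25Printed` -/

section Carrier

variable {D : LocDomainSys} {Φ : Type}

/-- The polymer activities of (24)–(25) INDUCED by a localized family `E` over a `LocDomainSys`: polymers = the
localization domains, 𝓛 = the tree length `dj`, configurations = a set `R` of configurations lying in every domain's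
space (the real / minimal configurations U₁ of (25), inside all the complex analyticity neighbourhoods), activity = the
norm of the complex activity. [cite: Balaban1985UV3, (24)–(25) p.262] -/
def activitiesOf (D : LocDomainSys) (E : D.Dom → Φ → ℂ) (R : Set Φ) : B10.PolymerActivities where
  Poly := D.Dom
  Cfg := R
  ℒ := D.dj
  act X U := ‖E X (U : Φ)‖

/-- **(1.18) [Balaban1987RG1] ⇒ (25) [Balaban1985UV3] on the induced activities**: a family obeying `B13.Bound118 D sp E
E₀ κ` on spaces `sp X ⊇ R` obeys `B10.Bound25Printed (activitiesOf D E R) g κ (E₀/g)` for any `g > 0` (the printed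
`O(g₀)` written as `C·g₀`).  First consumer of the typed (25) carrier. [cite: Balaban1985UV3, (25) p.262] -/
theorem bound25_of_bound118 {sp : D.Dom → Set Φ} {E : D.Dom → Φ → ℂ} {R : Set Φ} (hR : ∀ X, R ⊆ sp X)
    {E₀ κ g : ℝ} (hg : 0 < g) (h : B13.Bound118 D sp E E₀ κ) :
    B10.Bound25Printed (activitiesOf D E R) g κ (E₀ / g) := by
  rintro X ⟨φ, hφ⟩
  change |‖E X φ‖| ≤ E₀ / g * g * Real.exp (-(κ * D.dj X))
  rw [abs_norm, div_mul_cancel₀ E₀ hg.ne', ← neg_mul]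
  exact h X φ (hR X hφ)

variable [DecidableEq D.Dom] {Q : Type} [DecidableEq Q] {S : Type} [Fintype S]
  {nbrs : Q → Finset Q} {cube : S → Q} {dom : S → List Q → D.Dom} {sp : D.Dom → Set Φ}
  {term : S → List Q → Φ → ℂ} {wd : S → List Q → ℝ} {cubes : D.Dom → Finset Q} {Dg V : ℕ}
  {A₀ C c M δ₀ Λ ℓ₀ ℓ₁ κ c₁ g : ℝ} {R : Set Φ}

/-- **(23) ⇒ (25), assembled**: walk terms obeying (23) with prefactor `A₀·g` (the coupling carried by the vertices),
the rescaling law, the walk-state counts `D𝔤, V` and the volume law `#cubes(X) ≤ c₁(1 + 𝓛(X))` (`B13.VolBoundK1`) give,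
for every `κ ≥ 0` and every `M ≥ max(2κΛ/δ₀, 2·D𝔤·c·e^{κℓ₀})`, the printed (25) on the induced activities:
`|𝒫′(X, U)| ≤ (2A₀CVc₁e^{κℓ₁})·g·e^{−(κ−1)𝓛(X)}` — constant independent of M, rate `κ − 1` arbitrarily large with M.
(`B13.bound118_of_logHalfBound` BY NAME for the volume absorption.) [cite: Balaban1985UV3, (23)–(25) p.262] -/
theorem bound25_of_bound23 (hD : ∀ q, (nbrs q).card ≤ Dg)
    (hV : ∀ q : Q, (univ.filter fun b : S => cube b = q).card ≤ V)
    (hstart : ∀ b n ω, ω ∈ B9Thm37Sum.walksFrom nbrs n (cube b) → cube b ∈ cubes (dom b ω))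
    (hM : 0 < M) (hA₀ : 0 ≤ A₀) (hC : 0 ≤ C) (hc : 0 ≤ c) (hδ₀ : 0 < δ₀) (hκ : 0 ≤ κ) (hg : 0 < g)
    (hMκ : 2 * κ * Λ / δ₀ ≤ M) (hMent : 2 * (Dg * (c * Real.exp (κ * ℓ₀))) ≤ M)
    (h23 : WalkTermBound23 D nbrs cube dom sp term wd (A₀ * g) C c M δ₀)
    (hsc : RescaleLaw D nbrs cube dom wd M Λ ℓ₀ ℓ₁)
    (hvol : B13.VolBoundK1 D (fun X => (cubes X).card) c₁) (hR : ∀ X, R ⊆ sp X) :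
    B10.Bound25Printed (activitiesOf D (B10LogDet63.Elog nbrs cube dom term) R) g (κ - 1)
      (2 * A₀ * C * Real.exp (κ * ℓ₁) * V * c₁) := by
  have hlog := rate25 (cubes := cubes) hD hV hstart hM (by positivity) hC hc hδ₀ hκ hMκ hMent h23 hsc
  have h118 := B13.bound118_of_logHalfBound D sp _ _ (by positivity) hlog hvol
  have h := bound25_of_bound118 hR hg h118
  have hc : 2 * (A₀ * g * C * Real.exp (κ * ℓ₁) * V) * c₁ / g = 2 * A₀ * C * Real.exp (κ * ℓ₁) * V * c₁ := by
    field_simp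
  rw [hc] at h
  exact h

end Carrier

end Literature.MathematicalPhysics.QuantumFieldTheory.Balaban1983to89.B10Eq25Rate

end
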